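import Literature.AlgebraicGeometry.HodgeTheory.HodgeLociOfGriffiths
import Literature.AlgebraicGeometry.HodgeTheory.UniversalHypersurfaceHodgeLoci
import Literature.AlgebraicGeometry.Motives.UniversalHypersurfaceQuasiProjective
import HarnessLib

/-!
# Lemma 5.13 for the universal family of hypersurfaces, from Griffiths' theorem — the hypothesis `hcl`
# of the Noether–Lefschetz reduction `UniversalHypersurfaceHodgeLoci` discharged by name

Family `hodge`, layer `Literature/AlgebraicGeometry/HodgeTheory`; proof file (theorems only, no definition,
no named fact).

`UniversalHypersurfaceHodgeLoci.exists_forall_isIntegralClass_imp_eq_zero_of_climb_of_closed` reduces the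
one-model Noether–Lefschetz statement (some fibre of the universal family `π : 𝒴_U → U` of smooth degree-`d`
hypersurfaces in `ℙⁿ⁺¹_ℂ` has no non-zero integral class in `FʳHⁿ`) to two analytic hypotheses on the
variation of Hodge structure of `π`: `hclimb` (Voisin II Cor. 5.17 + Thm. 6.13 + Macaulay) and `hcl`
(Voisin II Lemma 5.13: the loci `{u : ξ|_{Y_u} ∈ Fʳ}` of tube classes are closed). Here `hcl` is
DISCHARGED from the general named fact `Griffiths1968_holomorphicHodgeSubbundles` (Voisin I Thm. 10.3)
through the general theorem `isInHodgeFiltration_fiberRestrict_of_mem_closure_of_griffiths1968`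
(`HodgeLociOfGriffiths`): the universal family is a smooth projective family over the smooth
quasi-projective base `U` (`isSmoothProjectiveFamily_family`, `isQuasiProjectiveOver_base`,
`smoothOfRelativeDimension_base_hom`).

* `UniversalHypersurface.isInHodgeFiltration_of_mem_closure_of_griffiths1968` — `hcl` for `family ℂ n d`;
* `UniversalHypersurface.exists_forall_isIntegralClass_imp_eq_zero_of_climb_of_griffiths1968`,
  `UniversalHypersurface.exists_isSmoothHypersurface_forall_isIntegralClass_imp_eq_zero_of_climb_of_griffiths1968`
  — the Noether–Lefschetz conclusions from `hclimb` alone, granted Griffiths' theorem.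

Consumer: the barrier fact `Voisin2003_generalHypersurface_noIntegralClassInF` from {Griffiths 1968, `hclimb`}
(`Barriers/HodgeConjecture/NormalFunctionsOfGriffiths`). Seat hodge-nonav 20241-p1 g12.

## References

* [VoisinHodgeII2003] C. Voisin, Hodge Theory and Complex Algebraic Geometry II, CUP (2003), §5.3.1
  Lemma 5.13, §5.3.2 Cor. 5.17, Thm. 6.24 (proof), Lemma 8.18 (proof).
* [VoisinHodgeI2002] C. Voisin, Hodge Theory and Complex Algebraic Geometry I, CUP (2002), §10.2.1 Thm. 10.3.
-/

noncomputable section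

open CategoryTheory AlgebraicGeometry
open _root_.Topology _root_.Filter
open Literature.AlgebraicTopology.SingularHomology

namespace Literature.AlgebraicGeometry.HodgeTheory

namespace UniversalHypersurface

open Motives.UniversalHypersurface Literature.AlgebraicGeometry.Motives

variable (n d : ℕ)

/-- **Voisin II Lemma 5.13 for the universal family of smooth hypersurfaces, from Griffiths' theorem**:
the locus `{u ∈ B | ξ|_{Y_u} ∈ FʳHⁿ(Y_u)}` of a tube class `ξ ∈ Hⁿ(π⁻¹B(ℂ); ℂ)` is closed in the open
`B ⊆ U(ℂ)` — VERBATIM the hypothesis `hcl` of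
`exists_forall_isIntegralClass_imp_eq_zero_of_climb_of_closed`, granted `Griffiths1968_holomorphicHodgeSubbundles`.
[cite: VoisinHodgeII2003, §5.3.1 Lemma 5.13] [cite: VoisinHodgeI2002, §10.2.1 Thm. 10.3] -/
theorem isInHodgeFiltration_of_mem_closure_of_griffiths1968 (hG : Griffiths1968_holomorphicHodgeSubbundles)
    (hn : 1 ≤ n) (hd : 1 ≤ d) (r : ℕ) :
    ∀ (B : Set (universalHypersurfaceBasePoints n d)), IsOpen B →
      ∀ (ξ : singularCohomology ℂ ℂ (tubeOver (family ℂ n d) B) n)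
        (u : universalHypersurfaceBasePoints n d) (hu : u ∈ B),
        u ∈ closure {u' | ∃ hu' : u' ∈ B,
          IsInHodgeFiltration n (Motives.fiberOver (family ℂ n d) u') n r
            (fiberRestrict (family ℂ n d) hu' n ξ)} →
        IsInHodgeFiltration n (Motives.fiberOver (family ℂ n d) u) n r
          (fiberRestrict (family ℂ n d) hu n ξ) := by
  intro B hBo ξ u hu hcl
  haveI := smoothOfRelativeDimension_base_hom ℂ n d
  exact isInHodgeFiltration_fiberRestrict_of_mem_closure_of_griffiths1968 hG (family ℂ n d) n n
    (0 + Fintype.card (DegIndex n d)) (isSmoothProjectiveFamily_family ℂ hn hd)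
    (isQuasiProjectiveOver_base ℂ n d) hBo ξ r hu hcl

/-- **The one-model Noether–Lefschetz statement from Cor. 5.17 ∕ Thm. 6.13 (`hclimb`) ALONE, granted
Griffiths' theorem**: some fibre `Y_s` of the universal family, with a Hodge model `A`, has no non-zero
integral class of `Hⁿ(Y_s(ℂ); ℂ)` pulling back into `FʳHⁿ(A)` —
`exists_forall_isIntegralClass_imp_eq_zero_of_climb_of_closed` with `hcl` discharged.
[cite: VoisinHodgeII2003, Lemma 8.18 (proof), Thm. 6.24 (proof), Cor. 5.17 and Lemma 5.13]
[cite: VoisinHodgeI2002, §10.2.1 Thm. 10.3] -/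
theorem exists_forall_isIntegralClass_imp_eq_zero_of_climb_of_griffiths1968
    (hG : Griffiths1968_holomorphicHodgeSubbundles) (hn : 1 ≤ n) (hd : 1 ≤ d) {r : ℕ} (hr : r ≤ n + 1)
    (hclimb : ∀ (B : Set (universalHypersurfaceBasePoints n d)), IsOpen B →
      ∀ (ξ : singularCohomology ℂ ℂ (tubeOver (family ℂ n d) B) n) (p : ℕ), r ≤ p → p ≤ n →
      ∀ (u : universalHypersurfaceBasePoints n d) (hu : u ∈ B),
        (∀ᶠ u' in 𝓝 u, ∃ hu' : u' ∈ B,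
          IsInHodgeFiltration n (Motives.fiberOver (family ℂ n d) u') n p
            (fiberRestrict (family ℂ n d) hu' n ξ)) →
        IsInHodgeFiltration n (Motives.fiberOver (family ℂ n d) u) n (p + 1)
          (fiberRestrict (family ℂ n d) hu n ξ)) :
    ∃ (s : universalHypersurfaceBasePoints n d) (A : HodgeModel n (Motives.fiberOver (family ℂ n d) s)),
      ∀ c : complexBetti (Motives.fiberOver (family ℂ n d) s) n,
        IsIntegralClass c → A.pullback n c ∈ A.hodgeFiltration n r → c = 0 :=
  exists_forall_isIntegralClass_imp_eq_zero_of_climb_of_closed n d hn hd hr hclimb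
    (isInHodgeFiltration_of_mem_closure_of_griffiths1968 n d hG hn hd r)

/-- **A smooth hypersurface of degree `d` in `ℙⁿ⁺¹` with no non-zero integral class in `FʳHⁿ`, from
`hclimb` alone, granted Griffiths' theorem** (`exists_isSmoothHypersurface_…_of_climb_of_closed` with `hcl`
discharged). [cite: VoisinHodgeII2003, Lemma 8.18 (proof) and Thm. 6.24] [cite: VoisinHodgeI2002, §10.2.1 Thm. 10.3] -/
theorem exists_isSmoothHypersurface_forall_isIntegralClass_imp_eq_zero_of_climb_of_griffiths1968
    (hG : Griffiths1968_holomorphicHodgeSubbundles) (hn : 1 ≤ n) (hd : 1 ≤ d) {r : ℕ} (hr : r ≤ n + 1)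
    (hclimb : ∀ (B : Set (universalHypersurfaceBasePoints n d)), IsOpen B →
      ∀ (ξ : singularCohomology ℂ ℂ (tubeOver (family ℂ n d) B) n) (p : ℕ), r ≤ p → p ≤ n →
      ∀ (u : universalHypersurfaceBasePoints n d) (hu : u ∈ B),
        (∀ᶠ u' in 𝓝 u, ∃ hu' : u' ∈ B,
          IsInHodgeFiltration n (Motives.fiberOver (family ℂ n d) u') n p
            (fiberRestrict (family ℂ n d) hu' n ξ)) →
        IsInHodgeFiltration n (Motives.fiberOver (family ℂ n d) u) n (p + 1)
          (fiberRestrict (family ℂ n d) hu n ξ)) :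
    ∃ X : Motives.SchemeOver ℂ, Motives.IsSmoothHypersurface n d X ∧ ∃ A : HodgeModel n X,
      ∀ c : complexBetti X n, IsIntegralClass c → A.pullback n c ∈ A.hodgeFiltration n r → c = 0 :=
  exists_isSmoothHypersurface_forall_isIntegralClass_imp_eq_zero_of_climb_of_closed n d hn hd hr hclimb
    (isInHodgeFiltration_of_mem_closure_of_griffiths1968 n d hG hn hd r)

end UniversalHypersurface

end Literature.AlgebraicGeometry.HodgeTheory

end
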